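import Summits.HodgeConjecture.HodgeConjecture.Theorems.EightfoldBlochSeedsChernCharacterOnBettiAnalytificationSupported
import Summits.HodgeConjecture.HodgeConjecture.Theorems.EightfoldBlochSeedsChernCharacterOnBettiAnalytificationVectorBundle
import Literature.AlgebraicGeometry.HodgeTheory.GenericSectionsDependencyLocus
import HarnessLib

/-!
# K1 → cycle law (K3 route): the Chern classes of a GLOBALLY GENERATED vector bundle are algebraic,
# granted the codimension of the dependency locus of general sections

Route `EightfoldBlochSeeds` / item `stmt-HodgeConjecture-19780` (`ChernCharacterOnBetti`), helper
(`--supports`). HONEST FRAMING: nothing here proves 19780 / 18880 / 18882 / 18883 / H2 / HC_AV / HC;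
no definition; each theorem is CONDITIONAL on the named fact `GenericSectionsDependencyLocus`
(Fulton Example 14.3.2 (b)+(d), `Literature/AlgebraicGeometry/HodgeTheory/GenericSectionsDependencyLocus`)
taken as a hypothesis (D-0014).

WHAT. The degeneracy-locus (K3) route to the field `ch_mem_algebraicClasses`, ALGEBRAIC HALF supplied:
for a vector bundle `F` with frames of size `r` on a smooth projective `X`, generated by finitely many
global sections, a topological analytification datum `(E, α)` of rank `r`, and `1 ≤ i ≤ r`:
`cᵢ(E)_ℂ ∈ algebraicClasses X i` (`chernClassIn_complex_mem_algebraicClasses_of_comparison_of_genericSections`).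
The named fact gives `r - i + 1` global sections fibrewise independent off a closed set of codimension
`≥ i`; the tree's PROVED topological half (`…AnalytificationSupported`:
`chernClassIn_complex_mem_algebraicClasses_of_comparison_sections`, Milnor–Stasheff §4 / §14) concludes.
Packaged with the existence of a datum (`…AnalytificationVectorBundle`) as
`exists_analytification_chernClassIn_mem_algebraicClasses_of_genericSections`.

This route is INDEPENDENT of the splitting-principle route (`…AnalytificationFlagBundle`, which covers
every vector bundle granted `FlagBundleSplitting` / one level of `𝐏(ℰ)`); it covers globally generated
bundles granted Kleiman–Bertini genericity instead.

[cite: Fulton1998, Example 14.3.2 (b), (d), Thm. 14.4 and Prop. 19.1.2] [cite: MilnorStasheff1974, §4 Prop. 4 and §14]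
[cite: SerreGAGA1956, §3 n°9 Prop. 10 and n°11]
-/

noncomputable section

-- single-problem summit (Problem = Summit): the mandated namespace repeats `HodgeConjecture`.
set_option linter.dupNamespace false

open CategoryTheory AlgebraicGeometry Bundle Topology
open Literature.AlgebraicGeometry.Motives Literature.AlgebraicGeometry.HodgeTheory
open Literature.AlgebraicTopology.SingularHomology Literature.AlgebraicTopology.CharacteristicClasses

namespace Summit.HodgeConjecture.HodgeConjecture.Theorems

variable {n : ℕ} {X : SchemeOver ℂ} {F : X.left.Modules} {r : ℕ}

/-- **`cᵢ(F(ℂ))_ℂ ∈ algebraicClasses X i`, `1 ≤ i ≤ r`, for a globally generated vector bundle `F` of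
rank `r` on a smooth projective `X`, granted `GenericSectionsDependencyLocus`**, for every topological
analytification datum `(E, α)` of rank `r` (general sections are independent off a codimension-`i`
locus; the Chern classes of a bundle with `r - i + 1` independent sections off `Z` are supported on `Z`).
[cite: Fulton1998, Example 14.3.2 (b), (d) and Prop. 19.1.2] [cite: MilnorStasheff1974, §4 Prop. 4 and §14] -/
theorem chernClassIn_complex_mem_algebraicClasses_of_comparison_of_genericSections
    (hGS : GenericSectionsDependencyLocus) (hX : IsSmoothProjective n X)
    (hFr : ∀ x : X.left, ∃ (U : X.left.Opens) (s : Fin r → Γ(F, U)), x ∈ U ∧ IsSectionFrame F U s)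
    (hgen : ∃ (N : ℕ) (σ : Fin N → Γ(F, ⊤)), ∀ x : X.left, ∃ U : X.left.Opens, x ∈ U ∧
      ∀ t : Γ(F, U), t ∈ Submodule.span Γ(X.left, U)
        (Set.range fun j ↦ F.presheaf.map (homOfLE le_top).op (σ j)))
    (E : ComplexVectorBundle.{0, 0} (ComplexPoints X)) (hrank : E.rank = r)
    (α : ∀ U : X.left.Opens, Γ(F, U) → ∀ P : ComplexPoints X, E.E P)
    (hres : ∀ (U W : X.left.Opens) (hWU : W ≤ U) (σ : Γ(F, U)) (P : ComplexPoints X), P.pt ∈ W →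
      α W (F.presheaf.map (homOfLE hWU).op σ) P = α U σ P)
    (hcont : ∀ (U : X.left.Opens) (σ : Γ(F, U)),
      ContinuousOn (fun P ↦ (⟨P, α U σ P⟩ : TotalSpace E.F E.E)) {P | P.pt ∈ U})
    (hframe : ∀ (U : X.left.Opens) (t : Fin r → Γ(F, U)), IsSectionFrame F U t →
      ∀ P : ComplexPoints X, P.pt ∈ U → LinearIndependent ℂ (fun j ↦ α U (t j) P) ∧
        ⊤ ≤ Submodule.span ℂ (Set.range fun j ↦ α U (t j) P))
    {i : ℕ} (hi0 : 1 ≤ i) (hi : i ≤ r) :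
    theChernClassTheory.chernClassIn ℂ E i ∈ algebraicClasses X i := by
  obtain ⟨s, U, hcodim, hs⟩ := hGS n X hX F r hFr hgen i hi0 hi
  refine chernClassIn_complex_mem_algebraicClasses_of_comparison_sections hX E α hres hcont hframe hcodim
    (fun k ↦ F.presheaf.map (homOfLE le_top).op (s k)) (fun x hx ↦ ?_) (by rw [hrank]; omega) hi0
  obtain ⟨W, hWU, t, ι, hxW, hι, ht, hts⟩ := hs x hx
  refine ⟨W, hWU, t, ι, hxW, hι, ht, fun k ↦ ?_⟩
  rw [hts k, presheaf_map_map F le_top hWU (s k)]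

/-- **Packaged with the existence of a datum**: granted `GenericSectionsDependencyLocus`, a globally
generated vector bundle `F` on a smooth projective `X` over `ℂ` has a topological analytification
`(E, α)` of some rank `r` with `cᵢ(E)_ℂ ∈ algebraicClasses X i` for all `1 ≤ i ≤ r`.
[cite: SerreGAGA1956, §3 n°9 Déf. 2, Prop. 10 and §4 n°20] [cite: Fulton1998, Example 14.3.2 (b), (d) and Prop. 19.1.2] -/
theorem exists_analytification_chernClassIn_mem_algebraicClasses_of_genericSections
    (hGS : GenericSectionsDependencyLocus) (hX : IsSmoothProjective n X) (hF : IsVectorBundle F)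
    (hgen : ∃ (N : ℕ) (σ : Fin N → Γ(F, ⊤)), ∀ x : X.left, ∃ U : X.left.Opens, x ∈ U ∧
      ∀ t : Γ(F, U), t ∈ Submodule.span Γ(X.left, U)
        (Set.range fun j ↦ F.presheaf.map (homOfLE le_top).op (σ j))) :
    ∃ (r : ℕ) (E : ComplexVectorBundle.{0, 0} (ComplexPoints X))
      (α : ∀ U : X.left.Opens, Γ(F, U) → ∀ P : ComplexPoints X, E.E P),
      E.rank = r ∧
      (∀ x : X.left, ∃ (U : X.left.Opens) (s : Fin r → Γ(F, U)), x ∈ U ∧ IsSectionFrame F U s) ∧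
      (∀ (U : X.left.Opens) (σ : Γ(F, U)),
          ContinuousOn (fun P ↦ (⟨P, α U σ P⟩ : TotalSpace E.F E.E)) {P | P.pt ∈ U}) ∧
      (∀ (U : X.left.Opens) (t : Fin r → Γ(F, U)), IsSectionFrame F U t → ∀ P : ComplexPoints X,
          P.pt ∈ U → LinearIndependent ℂ (fun j ↦ α U (t j) P) ∧
            ⊤ ≤ Submodule.span ℂ (Set.range fun j ↦ α U (t j) P)) ∧
      ∀ i : ℕ, 1 ≤ i → i ≤ r → theChernClassTheory.chernClassIn ℂ E i ∈ algebraicClasses X i := by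
  obtain ⟨r, E, α, hrank, hfr, -, -, hres, hcont, hframe⟩ :=
    exists_topologicalAnalytification_of_isVectorBundle hX hF
  exact ⟨r, E, α, hrank, hfr, hcont, hframe, fun i hi0 hi ↦
    chernClassIn_complex_mem_algebraicClasses_of_comparison_of_genericSections hGS hX hfr hgen E hrank α
      hres hcont hframe hi0 hi⟩

end Summit.HodgeConjecture.HodgeConjecture.Theorems

end
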